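import Summits.BirchSwinnertonDyer.BirchSwinnertonDyer.Theorems.GenusKolyvaginAtTwoGenusPrimitiveSupplyAtTwoTwistingPrimeTwin
import Summits.BirchSwinnertonDyer.BirchSwinnertonDyer.Theorems.GenusKolyvaginAtTwoGenusPrimitiveSupplyAtTwoTwistingPrime
import Summits.BirchSwinnertonDyer.BirchSwinnertonDyer.Theorems.GenusKolyvaginAtTwoGenusPrimitiveSupplyAtTwoPrimeHeegnerTwinStubA
import HarnessLib

/-!
# Route `GenusKolyvaginAtTwo`, crux #2 `GenusPrimitiveSupplyAtTwo` (stmt-BirchSwinnertonDyer-22136):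
# the GENUS PAIR at a Kolyvagin prime is `2`-Selmer-minimal (LEVEL LAW supply, Selmer side) and
# STUB A on WALL row 1 with DEF `= 1` BY NAME — both modulo Mazur–Rubin Cor. 3.4 (i) only

Width seat `bsd-line-gk2-p4` g7, cell `bsd-f1-sign2`; helper (`--supports stmt-BirchSwinnertonDyer-22136`),
sixth file of the twisting-prime series. THEOREMS ONLY: no definition, no named fact, no `sorry`; no
item is closed; BSD is not proved by any of this.

`exists_kolyvaginPrime_genusPair_selmer_of_cor34i`: `W/ℚ` globally minimal elliptic, `Δ(W) < 0`,
`ρ̄_{W,2}` onto, `#Sel₂(W) = 4` (all of WALL row 1), `K` imaginary quadratic, `Wd` a globally minimal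
model of the twin `W^{(d_K)}` with `#Sel₂(Wd) = 2`, `B₀` finite ⟹ a prime `ℓ ∉ B₀`, `ℓ ≡ 7 (mod 8)`,
Kolyvagin for `(E, K, 2)` in Gross's sense (depth one), such that EVERY elliptic model of `W^{(−ℓ)}` has
`#Sel₂ = 2` and every elliptic model of `Wd^{(−ℓ)}` has `#Sel₂ = 1` (`−ℓ = ℓ*`): the genus pair
`(E^{(ℓ*)}, E^{(ℓ*d_K)})` is `2`-Selmer-minimal. Assembly of the unconditional Čebotarev theorem
`exists_kolyvaginPrime_not_selmerGroup_le_strictLocalKer_twin` (`…TwistingPrimeTwin`) with gk2-p5's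
Cor. 3.4 (i) dichotomy at the prime of the prime Heegner field `ℚ(√−ℓ)` (`…PrimeHeegnerTwinDichotomy`,
`…PrimeHeegnerTwinRowOne`) for `W` AND for `Wd`. Trust base: `MazurRubin2010.cor34i_singleton_rat`
(PRINT) only. This is the factor «SUPPLY [Chebotarev + MR]» of the LEVEL LAW
(`Cruxes/GenusPrimitiveSupplyAtTwo/Lines/genus-supply-depthlaw.md` §3) at prime level (`t = 1`, the
census case); the other factor, EXACT-INDEX₂ (W. Zhang at `2`), is the open kernel and is untouched.

Also `stubA_rowOne_of_cor34i_of_twoConverse` / `stubA_rowOne_of_items`: the twin-supply stub A of crux 22136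
ON ALL OF ROW 1 (`Δ < 0`, `#Sel₂(E) = 4`) with DEF `= 1`, beyond every bound — `K = ℚ(√−ℓ)` at a twisting
prime `ℓ`, a globally minimal twin with `¬CM`, `r_an = 1`, `#Sel₂ = 2` — modulo cor34i + the route's items
`ModularityExistsNewform`, `TwoParityDD`, `RankOneTwoConverse`, `RankOneTwoConverseOffSemistableAtTwo` BY
NAME (row-1 companion of gk2-p5's `stubA_DEF1_of_items`, which covers `#Sel₂(E) = 1`).

References: [MazurRubin2010] Cor. 3.4 (i), Prop. 3.3, Lemma 3.5; [GrossLMS1991] §3;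
[DokchitserDokchitserAnnals2010] Thm. 1.4.
-/

set_option linter.dupNamespace false -- tree convention: `Summit.BirchSwinnertonDyer.BirchSwinnertonDyer.Theorems` (summit = sub-problem)
set_option autoImplicit false

noncomputable section

open scoped Classical Pointwise

namespace Summit.BirchSwinnertonDyer.BirchSwinnertonDyer.Theorems.GenusKolyTwistingPrime

open WeierstrassCurve NumberField IsDedekindDomain Field
open Literature.NumberTheory.GaloisRepresentations Literature.NumberTheory.EllipticCurves
open Literature.NumberTheory

/-! ## §14 Capstone: the genus pair at a Kolyvagin prime is `2`-Selmer-minimal (mod Cor. 3.4 (i) only) -/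

section GenusPair

variable (W : WeierstrassCurve ℚ) [W.IsElliptic] [W.IsGloballyMinimal] {K : Type} [Field K] [NumberField K]

/-- **PRIME-LEVEL SUPPLY OF THE LEVEL LAW, SELMER SIDE (WALL row 1), modulo Mazur–Rubin Cor. 3.4 (i)
ONLY.** Let `W/ℚ` be globally minimal elliptic with `Δ(W) < 0`, `ρ̄_{W,2}` onto and `#Sel₂(W) = 4`
(`s_E = 2`), `K` an imaginary quadratic field, and `Wd` a globally minimal (elliptic) model of the twin
`W^{(d_K)}` with `#Sel₂(Wd) = 2`. Then beyond every finite set `B₀` there is a prime `ℓ ≡ 7 (mod 8)`,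
a KOLYVAGIN PRIME for `(E, K, 2)` in Gross's sense (`ℓ ∤ 2N d_K`, inert in `K`, `Frob_ℓ = Frob_∞` on
`K(E[2])`; depth one), such that the GENUS PAIR is `2`-Selmer-minimal: EVERY elliptic model of
`W^{(−ℓ)}` has `#Sel₂ = 2` and every elliptic model of `Wd^{(−ℓ)}` has `#Sel₂ = 1` (`−ℓ = ℓ*`). Assembly:
`exists_kolyvaginPrime_not_selmerGroup_le_strictLocalKer_twin` (unconditional Čebotarev, with
`8·N_W·N_{Wd} ∣ ℓ + 1`) + gk2-p5's `cor34i_twin_prime_heegner` for `W` and for `Wd` over the prime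
Heegner fields `exists_heegnerField_of_prime`. The only named fact in the cone is
`MazurRubin2010.cor34i_singleton_rat` (PRINT). This is the «SUPPLY [Chebotarev + MR]» factor of
`Lines/genus-supply-depthlaw.md` §3 at prime level; EXACT-INDEX₂ (W. Zhang at `2`) is untouched. BSD is
not proved by this. [cite: MazurRubin2010, Cor. 3.4 (i), Prop. 3.3, Lemma 3.5]
[cite: GrossLMS1991, §3 (3.1)–(3.2)] -/
theorem exists_kolyvaginPrime_genusPair_selmer_of_cor34i (h34 : MazurRubin2010.cor34i_singleton_rat)
    (hsurj : W.HasSurjectiveModNGaloisRep 2) (hΔ : W.Δ < 0) (h4 : Nat.card (W.selmerGroup 2) = 4)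
    (hK : IsImaginaryQuadratic K) {Wd : WeierstrassCurve ℚ} [Wd.IsElliptic] [Wd.IsGloballyMinimal]
    {C : VariableChange ℚ} (hWd : C • W.quadraticTwist (discr K : ℚ) = Wd)
    (h2 : Nat.card (Wd.selmerGroup 2) = 2) (B₀ : Finset ℕ) :
    ∃ ℓ : ℕ, ∃ _ : Fact ℓ.Prime, ℓ ∉ B₀ ∧ ℓ % 8 = 7 ∧ IsKolyvaginPrime (W.conductorNorm ℤ) W K 2 ℓ ∧
      (∀ (W₁ : WeierstrassCurve ℚ) [W₁.IsElliptic],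
        (∃ C₁ : VariableChange ℚ, C₁ • W.quadraticTwist (-(ℓ : ℚ)) = W₁) →
          Nat.card (W₁.selmerGroup 2) = 2) ∧
      (∀ (W₂ : WeierstrassCurve ℚ) [W₂.IsElliptic],
        (∃ C₂ : VariableChange ℚ, C₂ • Wd.quadraticTwist (-(ℓ : ℚ)) = W₂) →
          Nat.card (W₂.selmerGroup 2) = 1) := by
  have hNW : W.conductorNorm ℤ ≠ 0 := (W.conductorNorm_pos_holds).ne'
  have hNWd : Wd.conductorNorm ℤ ≠ 0 := (Wd.conductorNorm_pos_holds).ne'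
  haveI : NeZero (W.conductorNorm ℤ) := ⟨hNW⟩
  have hd0 : (discr K : ℚ) ≠ 0 := by exact_mod_cast NumberField.discr_ne_zero K
  have hm : 8 * W.conductorNorm ℤ * Wd.conductorNorm ℤ ≠ 0 := by positivity
  have hSW : Nat.card (W.selmerGroup 2) ≠ 1 := by rw [h4]; norm_num
  have hSWd : Nat.card (Wd.selmerGroup 2) ≠ 1 := by rw [h2]; norm_num
  obtain ⟨ℓ, hℓF, hℓB₀, hmdvd, hKoly, hnsW, hnsWd⟩ :=
    exists_kolyvaginPrime_not_selmerGroup_le_strictLocalKer_twin W hsurj hΔ hK hd0 hWd hSW hSWd hm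
      (W.conductorNorm ℤ) B₀
  have hℓ : ℓ.Prime := hℓF.out
  have hℓ8 : ℓ % 8 = 7 := by
    have h8 : 8 ∣ ℓ + 1 := (Dvd.intro _ rfl).trans ((Dvd.intro _ rfl).trans hmdvd)
    omega
  have hcong : ∀ (M : ℕ), M ∣ 8 * W.conductorNorm ℤ * Wd.conductorNorm ℤ →
      ∀ p : ℕ, p.Prime → p ∣ M → p ≠ 2 → (ℓ : ZMod p) = -1 := by
    intro M hM p _ hp _
    have h : ((ℓ + 1 : ℕ) : ZMod p) = 0 :=
      (ZMod.natCast_eq_zero_iff _ _).mpr (hp.trans (hM.trans hmdvd))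
    rw [Nat.cast_add, Nat.cast_one] at h
    exact eq_neg_of_add_eq_zero_left h
  have hℓN : ∀ p : ℕ, p.Prime → p ∣ W.conductorNorm ℤ → p ≠ 2 → (ℓ : ZMod p) = -1 :=
    hcong _ ⟨8 * Wd.conductorNorm ℤ, by ring⟩
  have hℓNd : ∀ p : ℕ, p.Prime → p ∣ Wd.conductorNorm ℤ → p ≠ 2 → (ℓ : ZMod p) = -1 :=
    hcong _ ⟨8 * W.conductorNorm ℤ, by ring⟩
  -- the genus twist of `W`
  have hW₁ : ∀ (W₁ : WeierstrassCurve ℚ) [W₁.IsElliptic],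
      (∃ C₁ : VariableChange ℚ, C₁ • W.quadraticTwist (-(ℓ : ℚ)) = W₁) →
        Nat.card (W₁.selmerGroup 2) = 2 := by
    intro W₁ _ hW₁
    obtain ⟨-, -, K₁, _, _, hK₁, hd₁, hodd₁, -, hH₁, h2K₁, -, -⟩ :=
      GenusKolyTwin.exists_heegnerField_of_prime W hℓ hℓ8 hℓN
    have hW₁' : ∃ C₁ : VariableChange ℚ, C₁ • W.quadraticTwist (discr K₁ : ℚ) = W₁ := by
      rw [hd₁]; push_cast; exact hW₁
    exact (GenusKolyTwin.natCard_selmerGroup_twin_eq_two_iff_not_strict W h34 hΔ hK₁ hodd₁ hH₁ h2K₁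
      hd₁ W₁ hW₁' h4).mpr hnsW
  -- the genus twist of the twin
  have hΔd : Wd.Δ < 0 := by
    rw [← hWd, variableChange_Δ, quadraticTwist_Δ]
    have hu : (0 : ℚ) < ((C.u⁻¹ : ℚˣ) : ℚ) ^ 12 := Even.pow_pos (by decide) (Units.ne_zero _)
    have hd6 : (0 : ℚ) < (discr K : ℚ) ^ 6 := Even.pow_pos (by decide) hd0
    nlinarith [mul_pos hu hd6]
  have hW₂ : ∀ (W₂ : WeierstrassCurve ℚ) [W₂.IsElliptic],
      (∃ C₂ : VariableChange ℚ, C₂ • Wd.quadraticTwist (-(ℓ : ℚ)) = W₂) →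
        Nat.card (W₂.selmerGroup 2) = 1 := by
    intro W₂ _ hW₂
    obtain ⟨-, -, K₂, _, _, hK₂, hd₂, hodd₂, -, hH₂, h2K₂, -, -⟩ :=
      GenusKolyTwin.exists_heegnerField_of_prime Wd hℓ hℓ8 hℓNd
    have hW₂' : ∃ C₂ : VariableChange ℚ, C₂ • Wd.quadraticTwist (discr K₂ : ℚ) = W₂ := by
      rw [hd₂]; push_cast; exact hW₂
    have h := (GenusKolyTwin.cor34i_twin_prime_heegner Wd h34 hΔd hK₂ hodd₂ hH₂ h2K₂ hd₂ W₂ hW₂').2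
      hnsWd
    rw [h2] at h
    omega
  exact ⟨ℓ, hℓF, hℓB₀, hℓ8, hKoly, hW₁, hW₂⟩

end GenusPair

/-! ## §15 Stub A on WALL row 1 with DEF `= 1`, BY NAME (mod `cor34i_singleton_rat` + the route's items) -/

section StubARowOne

variable (W : WeierstrassCurve ℚ) [W.IsElliptic] [W.IsGloballyMinimal]

/-- **STUB A (the twin supply of crux 22136) ON WALL ROW 1 with DEF `= 1`**, modulo Mazur–Rubin Cor. 3.4 (i)
(PRINT), Modularity, the `2`-parity theorem and the clause-free rank-one `2`-converse: for `W/ℚ` globally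
minimal in the A-class (`¬CM`, `r_an = 0`, `ρ_{E,2^n}` onto for all `n ≥ 1`) with `Δ(W) < 0` and
`#Sel₂(W) = 4`, beyond every bound `b` there are a prime `ℓ > b` and `K = ℚ(√−ℓ)` carrying every
K-clause of the crux, `2` split, DEF `= 1`, and a GLOBALLY MINIMAL twin `Wd ≅ W^{(d_K)}` with `¬CM`,
`r_an(Wd) = 1` and `#Sel₂(Wd) = 2`. (`ℓ` is a twisting prime of `exists_twistingPrime`; the twin's
rank one: root number `−1` from Modularity + Heegner, odd `2^∞`-Selmer corank by `2`-parity, corank `1`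
from `#Sel₂ = 2`, analytic rank `1` by the `2`-converse — the lead's `…TwinConverse` chain.) Row-1
companion of gk2-p5's `stubA_DEF1_of_prop33_of_twoConverse` (`#Sel₂(W) = 1`).
[cite: MazurRubin2010, Cor. 3.4 (i)] [cite: DokchitserDokchitserAnnals2010, Thm. 1.4] -/
theorem stubA_rowOne_of_cor34i_of_twoConverse (h34 : MazurRubin2010.cor34i_singleton_rat)
    (hmod : ModularForms.exists_isNewformOf) (hpar : ∀ (V : WeierstrassCurve ℚ) [V.IsElliptic], p_parity V 2)
    (hconv : ∀ (V : WeierstrassCurve ℚ) [V.IsElliptic] [V.IsGloballyMinimal],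
      ¬ V.HasCM → V.selmerCorank 2 = 1 → V.analyticRank = 1)
    (hcm : ¬ W.HasCM) (hr0 : W.analyticRank = 0)
    (hρ : ∀ n : ℕ, 0 < n → W.HasSurjectiveModNGaloisRep ((2 : ℤ) ^ n)) (hΔ : W.Δ < 0)
    (h4 : Nat.card (W.selmerGroup 2) = 4) (b : ℕ) :
    ∃ (K : Type) (_ : Field K) (_ : NumberField K) (ℓ : ℕ), ℓ.Prime ∧ b < ℓ ∧
      IsImaginaryQuadratic K ∧ discr K = -(ℓ : ℤ) ∧ Odd (discr K) ∧ discr K ≠ -3 ∧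
      SatisfiesHeegnerHypothesis (W.conductorNorm ℤ) K ∧
      ¬ IsSquare ((discr K : ℚ) * -|W.Δ|) ∧ ¬ IsSquare ((discr K : ℚ) * (-(2 * |W.Δ|))) ∧
      ((Ideal.span {(2 : ℤ)}).primesOver (𝓞 K)).ncard = 2 ∧
      (∃! x : ZMod ℓ, 4 * x ^ 3 + ((integralModelInt W).b₂ : ZMod ℓ) * x ^ 2 +
        2 * ((integralModelInt W).b₄ : ZMod ℓ) * x + ((integralModelInt W).b₆ : ZMod ℓ) = 0) ∧
      ∃ (Wd : WeierstrassCurve ℚ) (_ : Wd.IsElliptic) (_ : Wd.IsGloballyMinimal),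
        (∃ C : VariableChange ℚ, C • W.quadraticTwist (discr K : ℚ) = Wd) ∧
        ¬ Wd.HasCM ∧ Wd.analyticRank = 1 ∧ Nat.card (Wd.selmerGroup 2) = 2 := by
  have hsurj : W.HasSurjectiveModNGaloisRep 2 := by simpa using hρ 1 one_pos
  obtain ⟨ℓ, hℓ, hbℓ, -, -, K, iF, iN, hK, hd, hodd, hd3, hH, hsq1, hsq2, h2K, hDEF, Wd, iE, iM, hWd,
    hSel⟩ := supply_DEF1_minimalTwin_rowOne_of_cor34i W h34 hΔ hsurj h4 b
  refine ⟨K, iF, iN, ℓ, hℓ, hbℓ, hK, hd, hodd, hd3, hH, hsq1, hsq2, h2K, hDEF, Wd, iE, iM, hWd, ?_, ?_,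
    hSel⟩
  · exact GenusKoly.twin_not_hasCM W hcm (by exact_mod_cast NumberField.discr_ne_zero K) Wd hWd
  · have hdK : (NumberField.discr K : ℚ) ≠ 0 := by exact_mod_cast NumberField.discr_ne_zero K
    have hcmd : ¬ Wd.HasCM := GenusKoly.twin_not_hasCM W hcm hdK Wd hWd
    have htors := GenusKoly.natCard_twoTorsion_twin_eq_one W (hρ 1 one_pos) hdK Wd hWd
    have hw := GenusKoly.rootNumber_twin_eq_neg_one hmod W hr0 K hK hH Wd hWd
    have hco := GenusKoly.selmerCorank_two_eq_one_of_card_selmerGroup_two Wd htors hSel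
      (GenusKoly.odd_selmerCorank_two_of_p_parity Wd (hpar Wd) hw)
    exact hconv Wd hcmd hco

/-- **The same with the inputs BY NAME as the route's items** (`ModularityExistsNewform` 19382,
`TwoParityDD` 24949, `RankOneTwoConverse` 19220, `RankOneTwoConverseOffSemistableAtTwo` 24948) and the print
fact `MazurRubin2010.cor34i_singleton_rat`: the SUPPLY half of crux 22136 on ALL of WALL row 1 (`Δ < 0`,
`#Sel₂(E) = 4`) in the DEF `= 1` / ∃K currency. [cite: MazurRubin2010, Cor. 3.4 (i)]
[cite: DokchitserDokchitserAnnals2010, Thm. 1.4] -/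
theorem stubA_rowOne_of_items (h34 : MazurRubin2010.cor34i_singleton_rat)
    (hmod : Summit.BirchSwinnertonDyer.BirchSwinnertonDyer.Theses.GenusKolyvaginAtTwo.ModularityExistsNewform)
    (hpar : Summit.BirchSwinnertonDyer.BirchSwinnertonDyer.Theses.GenusKolyvaginAtTwo.TwoParityDD)
    (hconv : Summit.BirchSwinnertonDyer.BirchSwinnertonDyer.Theses.GenusKolyvaginAtTwo.RankOneTwoConverse)
    (hconv' :
      Summit.BirchSwinnertonDyer.BirchSwinnertonDyer.Theses.GenusKolyvaginAtTwo.RankOneTwoConverseOffSemistableAtTwo)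
    (hcm : ¬ W.HasCM) (hr0 : W.analyticRank = 0)
    (hρ : ∀ n : ℕ, 0 < n → W.HasSurjectiveModNGaloisRep ((2 : ℤ) ^ n)) (hΔ : W.Δ < 0)
    (h4 : Nat.card (W.selmerGroup 2) = 4) (b : ℕ) :
    ∃ (K : Type) (_ : Field K) (_ : NumberField K) (ℓ : ℕ), ℓ.Prime ∧ b < ℓ ∧
      IsImaginaryQuadratic K ∧ discr K = -(ℓ : ℤ) ∧ Odd (discr K) ∧ discr K ≠ -3 ∧
      SatisfiesHeegnerHypothesis (W.conductorNorm ℤ) K ∧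
      ¬ IsSquare ((discr K : ℚ) * -|W.Δ|) ∧ ¬ IsSquare ((discr K : ℚ) * (-(2 * |W.Δ|))) ∧
      ((Ideal.span {(2 : ℤ)}).primesOver (𝓞 K)).ncard = 2 ∧
      (∃! x : ZMod ℓ, 4 * x ^ 3 + ((integralModelInt W).b₂ : ZMod ℓ) * x ^ 2 +
        2 * ((integralModelInt W).b₄ : ZMod ℓ) * x + ((integralModelInt W).b₆ : ZMod ℓ) = 0) ∧
      ∃ (Wd : WeierstrassCurve ℚ) (_ : Wd.IsElliptic) (_ : Wd.IsGloballyMinimal),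
        (∃ C : VariableChange ℚ, C • W.quadraticTwist (discr K : ℚ) = Wd) ∧
        ¬ Wd.HasCM ∧ Wd.analyticRank = 1 ∧ Nat.card (Wd.selmerGroup 2) = 2 := by
  refine stubA_rowOne_of_cor34i_of_twoConverse W h34 hmod (fun V _ => hpar V)
    (fun V _ _ hcmV hco => ?_) hcm hr0 hρ hΔ h4 b
  by_cases hred : (Rank1Residual.GoodOrd V 2 ∨ Rank1Residual.Mult V 2)
  · exact hconv V hcmV hred hco
  · exact hconv' V hcmV hred hco

end StubARowOne

end Summit.BirchSwinnertonDyer.BirchSwinnertonDyer.Theorems.GenusKolyTwistingPrime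

end
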